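import Literature.NumberTheory.ConnesMoscovici2022.UVProlateSpectrum
import Literature.Analysis.SpecialFunctions.FrullaniExp
import Mathlib.Analysis.Fourier.Inversion
import Mathlib.Analysis.SpecialFunctions.Gaussian.FourierTransform
import Mathlib.Analysis.Distribution.SchwartzSpace.Fourier
import Mathlib.MeasureTheory.Integral.Prod
import Mathlib.MeasureTheory.Group.Integral
import Mathlib.MeasureTheory.Measure.Haar.Unique
import HarnessLib

/-!
# Connes–Moscovici 2022, Lemma 1.4 (i): the Fourier transform of `½ log((λ² − x²)⁻²)` — PROOF

LINE 1 — FRAMING. RH-FREE corpus literature: a distributional Fourier identity on `ℝ`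
(the Fourier transform of `log|x|` away from the origin).  Sequel row of the Connes–Consani
corpus (UV prolate spectrum), no leaf role; bears_on: LADDER-RH W-C/W-P.  WHAT THIS IS NOT: any
claim about RH or about the prolate spectrum; nothing in this file bears on the truth of RH.

This file DISCHARGES the named fact
`Literature.NumberTheory.ConnesMoscovici2022.CM22_lemma_1_4_i` (typed, as printed, in
`UVProlateSpectrum.lean`): for `λ > 0` and every Schwartz function `φ` whose support stays away
from `0`,
`∫ ½ log((λ² − x²)⁻²) · 𝓕φ(x) dx = ∫ cos(2πλy)/|y| · φ(y) dy`,
i.e. "the Fourier transform `𝔽 f` of `f(x) = ½ log((λ² − x²)⁻²)` is a distribution which coincides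
outside `0` with the function `cos(2πλy)/|y|`".
[cite: ConnesMoscovici2022, Lemma 1.4 (i) (= arXiv:2112.05500 Lemma 2.4 (i), chunk p0005:L71–L74;
printed proof L79–L81)]

## The printed proof and the road taken here

Printed proof (arXiv chunk p0005:L79–L81): `f(x) = ½ log((λ − x)⁻²) + ½ log((λ + x)⁻²)`; for
`ℓ = −log(x²)` one has `x ∂ₓ ℓ = −2`, hence `∂_y (y ℓ̂) = 2`, so `y ℓ̂ = sign(y)` and `ℓ̂` is the
principal value `1/|y|`; translation of the variable multiplies by an imaginary exponential.
The two distributional steps ("`∂_y(yℓ̂) = 2 ⇒ yℓ̂ = sign y`", i.e. uniqueness of distributional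
primitives, and the identification of the principal value) have no counterpart in Mathlib, so the
SAME identity `𝓕(log|x|) = −1/(2|y|)` off `0` (weak form) is proved here by an elementary,
absolutely convergent computation:

* `1/(2|y|) = ∫₀^∞ e^{−π t² y²} dt` (`integral_gaussian_Ioi`), and Fubini;
* `∫ e^{−π t² y²} φ(y) dy = ∫ t⁻¹ e^{−π x²/t²} 𝓕φ(x) dx` (Fourier inversion for `φ`,
  self-adjointness of `𝓕` on `L¹`, and `fourier_gaussian_pi`);
* `∫ 𝓕φ = φ(0) = 0`, so the constant `t⁻¹ e^{−π/t²}` may be subtracted from the kernel — this is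
  exactly where "outside `0`" enters (the `δ₀`-component of `𝓕 log|x|` is invisible to such `φ`);
* the substitution `y = t⁻²` (`integral_comp_rpow_Ioi`) and Fubini again;
* the tree's exponential Frullani integral
  `Literature.Analysis.SpecialFunctions.integral_frullani_exp` (CITED, not restated):
  `∫₀^∞ (e^{−π x² y} − e^{−π y})/(2y) dy = ½ log(1/x²) = −log|x|`;
* translation `x ↦ x − a` turns `log|x|` into `log|x − a|` and `φ` into `e^{−2πiay} φ`;
  `a = ±λ` and `e^{−iθ} + e^{iθ} = 2 cos θ` finish.

## Main results (all RH-FREE; theorems only, no new definitions, no new named facts)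

* `integral_log_mul_fourier_eq` — **`𝓕(log|x|) = −1/(2|y|)` off `0`, weak form**: for `φ`
  continuous and integrable with `𝓕φ` integrable, `log|x| 𝓕φ(x)` absolutely integrable and `φ = 0`
  near `0`: `∫ log|x| 𝓕φ(x) dx = −∫ φ(y)/(2|y|) dy`; `integral_neg_log_sq_mul_fourier_eq` — the
  printed form "`ℓ̂ = 1/|y|` outside `0`" for `ℓ = −log(x²)`.
* `integral_log_sub_mul_fourier_schwartz` — the translated version for Schwartz `φ` with
  `0 ∉ tsupport φ`: `∫ log|x − a| 𝓕φ(x) dx = −∫ e^{−2πiay} φ(y)/(2|y|) dy`.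
* `integrable_norm_log_sub_mul` — `log|u − a| · ψ(u)` is integrable for Schwartz `ψ`.
* **`CM22_lemma_1_4_i_holds : CM22_lemma_1_4_i`** — the discharge.
(The computational steps A–E are private `[folklore]` helpers.)

(`Real.log x = Real.log |x|` in Mathlib, so `log|x|` is written `Real.log x` below.)

Nothing in this file bears on the truth of RH.
-/

noncomputable section

open MeasureTheory Set Filter SchwartzMap
open scoped Real Topology FourierTransform

namespace Literature.NumberTheory.ConnesMoscovici2022

/-! ### Step A: `1/(2|y|)` as a Gaussian integral -/

/-- `∫₀^∞ e^{−π t² y²} dt = 1/(2|y|)` for `y ≠ 0`. [folklore] -/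
private theorem integral_Ioi_exp_neg_pi_mul_sq_mul_sq {y : ℝ} (hy : y ≠ 0) :
    ∫ t in Ioi (0 : ℝ), Real.exp (-(π * t ^ 2 * y ^ 2)) = 1 / (2 * |y|) := by
  have h : (fun t : ℝ => Real.exp (-(π * t ^ 2 * y ^ 2))) =
      fun t => Real.exp (-(π * y ^ 2) * t ^ 2) := by
    funext t; congr 1; ring
  rw [h, integral_gaussian_Ioi]
  have hπ : (π : ℝ) ≠ 0 := Real.pi_ne_zero
  have hy2 : (y ^ 2 : ℝ) ≠ 0 := pow_ne_zero 2 hy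
  have : π / (π * y ^ 2) = (|y|⁻¹) ^ 2 := by
    rw [inv_pow, sq_abs]; field_simp
  rw [this, Real.sqrt_sq (inv_nonneg.2 (abs_nonneg y))]
  have hya : |y| ≠ 0 := abs_ne_zero.2 hy
  field_simp

/-! ### Step B: Fubini #1 — `∫ φ(y)/(2|y|) dy = ∫₀^∞ ∫ e^{−πt²y²} φ(y) dy dt` -/

/-- For `φ` continuous, integrable and vanishing on `(−δ, δ)`:
`∫ φ(y)/(2|y|) dy = ∫₀^∞ (∫ e^{−π t² y²} φ(y) dy) dt`. [folklore] -/
private theorem integral_inv_two_abs_mul_eq {φ : ℝ → ℂ} (hφc : Continuous φ) (hφi : Integrable φ)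
    {δ : ℝ} (hδ : 0 < δ) (h0 : ∀ y, |y| < δ → φ y = 0) :
    ∫ y : ℝ, ((1 / (2 * |y|) : ℝ) : ℂ) * φ y =
      ∫ t in Ioi (0 : ℝ), ∫ y : ℝ, (Real.exp (-(π * t ^ 2 * y ^ 2)) : ℂ) * φ y := by
  set F : ℝ → ℝ → ℂ := fun y t => (Real.exp (-(π * t ^ 2 * y ^ 2)) : ℂ) * φ y with hF
  have hyδ : ∀ y, φ y ≠ 0 → δ ≤ |y| := fun y hy => not_lt.1 fun h => hy (h0 y h)
  have hy0 : ∀ y, φ y ≠ 0 → y ≠ 0 := by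
    rintro y hy rfl
    exact hy (h0 0 (by simpa using hδ))
  -- the `y`-integrand as an inner integral
  have h1 : ∀ y : ℝ, ((1 / (2 * |y|) : ℝ) : ℂ) * φ y = ∫ t in Ioi (0 : ℝ), F y t := by
    intro y
    by_cases hy : φ y = 0
    · simp [hF, hy]
    rw [hF]
    simp only
    rw [integral_mul_const, integral_complex_ofReal, integral_Ioi_exp_neg_pi_mul_sq_mul_sq (hy0 y hy)]
  -- integrability on `ℝ × (0, ∞)`
  have hmeas : AEStronglyMeasurable (Function.uncurry F)
      ((volume : Measure ℝ).prod (volume.restrict (Ioi (0 : ℝ)))) := by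
    apply Continuous.aestronglyMeasurable
    exact (Complex.continuous_ofReal.comp (Real.continuous_exp.comp (by fun_prop))).mul
      (hφc.comp continuous_fst)
  have hint : Integrable (Function.uncurry F)
      ((volume : Measure ℝ).prod (volume.restrict (Ioi (0 : ℝ)))) := by
    rw [integrable_prod_iff hmeas]
    constructor
    · refine ae_of_all _ fun y => ?_
      by_cases hy : φ y = 0
      · have : (fun t => Function.uncurry F (y, t)) = fun _ => 0 := by
          funext t; simp [hF, hy]
        rw [this]
        exact integrable_zero _ _ _
      have hg : Integrable (fun t : ℝ => Real.exp (-(π * y ^ 2) * t ^ 2)) :=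
        integrable_exp_neg_mul_sq (by have := hy0 y hy; positivity)
      have hg' : Integrable (fun t : ℝ => (Real.exp (-(π * t ^ 2 * y ^ 2)) : ℂ))
          (volume.restrict (Ioi 0)) := by
        have := (hg.restrict (s := Ioi 0)).ofReal (𝕜 := ℂ)
        refine this.congr (ae_of_all _ fun t => ?_)
        simp only
        congr 2; ring
      simpa [hF, Function.uncurry] using hg'.mul_const (φ y)
    · have heq : (fun y => ∫ t in Ioi (0 : ℝ), ‖Function.uncurry F (y, t)‖) =
          fun y => (1 / (2 * |y|)) * ‖φ y‖ := by
        funext y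
        by_cases hy : φ y = 0
        · simp [hF, hy, Function.uncurry]
        simp only [Function.uncurry, hF, norm_mul, Complex.norm_real, Real.norm_eq_abs,
          abs_of_pos (Real.exp_pos _)]
        rw [integral_mul_const, integral_Ioi_exp_neg_pi_mul_sq_mul_sq (hy0 y hy)]
      rw [heq]
      have hm : Measurable fun y : ℝ => 1 / (2 * |y|) :=
        (measurable_const.mul continuous_abs.measurable).const_div 1
      refine Integrable.mono' (hφi.norm.const_mul (1 / (2 * δ)))
        (hm.aestronglyMeasurable.mul hφi.aestronglyMeasurable.norm) (ae_of_all _ fun y => ?_)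
      rw [Real.norm_eq_abs, abs_of_nonneg (by positivity)]
      by_cases hy : φ y = 0
      · simp [hy]
      · have := hyδ y hy
        gcongr
  -- swap
  calc ∫ y : ℝ, ((1 / (2 * |y|) : ℝ) : ℂ) * φ y
      = ∫ y : ℝ, ∫ t in Ioi (0 : ℝ), F y t := integral_congr_ae (ae_of_all _ h1)
    _ = ∫ t in Ioi (0 : ℝ), ∫ y : ℝ, F y t := integral_integral_swap hint

/-! ### Step C: `∫ e^{−πt²y²} φ = ∫ t⁻¹ e^{−πx²/t²} 𝓕φ` -/

/-- Self-adjointness of `𝓕` on `L¹(ℝ)`: `∫ 𝓕f · g = ∫ f · 𝓕g` (Mathlib's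
`VectorFourier.integral_fourierIntegral_smul_eq_flip` on `ℝ`). [folklore] -/
private theorem integral_fourier_mul_eq_flip_aux {f g : ℝ → ℂ} (hf : Integrable f)
    (hg : Integrable g) : ∫ ξ : ℝ, 𝓕 f ξ * g ξ = ∫ x : ℝ, f x * 𝓕 g x := by
  simpa using! VectorFourier.integral_fourierIntegral_smul_eq_flip (L := innerₗ ℝ)
    Real.continuous_fourierChar continuous_inner hf hg

/-- For `φ` continuous and integrable with `𝓕φ` integrable and `t > 0`:
`∫ e^{−π t² y²} φ(y) dy = ∫ t⁻¹ e^{−π x²/t²} 𝓕φ(x) dx` (Fourier inversion, self-adjointness of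
`𝓕`, and the Gaussian `𝓕(e^{−πt²y²})(x) = t⁻¹ e^{−πx²/t²}`). [folklore] -/
private theorem integral_gaussian_mul_eq_integral_fourier {φ : ℝ → ℂ} (hφc : Continuous φ)
    (hφi : Integrable φ) (hψi : Integrable (𝓕 φ)) {t : ℝ} (ht : 0 < t) :
    ∫ y : ℝ, (Real.exp (-(π * t ^ 2 * y ^ 2)) : ℂ) * φ y =
      ∫ x : ℝ, ((t⁻¹ * Real.exp (-(π * x ^ 2 / t ^ 2)) : ℝ) : ℂ) * 𝓕 φ x := by
  set G : ℝ → ℂ := fun y => Complex.exp (-π * (t : ℂ) ^ 2 * (y : ℂ) ^ 2) with hG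
  have hGeq : ∀ y : ℝ, (Real.exp (-(π * t ^ 2 * y ^ 2)) : ℂ) = G y := by
    intro y
    rw [hG, Complex.ofReal_exp]
    congr 1
    push_cast
    ring
  have hGev : ∀ y : ℝ, G (-y) = G y := by
    intro y; simp only [hG]; push_cast; ring_nf
  have hb : 0 < (((t : ℂ)) ^ 2).re := by
    rw [← Complex.ofReal_pow, Complex.ofReal_re]; positivity
  have hGi : Integrable G := by
    have hb' : 0 < ((π : ℂ) * (t : ℂ) ^ 2).re := by
      rw [← Complex.ofReal_pow, ← Complex.ofReal_mul, Complex.ofReal_re]; positivity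
    refine (integrable_cexp_neg_mul_sq hb').congr (ae_of_all _ fun y => ?_)
    simp only [hG]
    congr 1
    ring
  have hcpow : ((t : ℂ) ^ 2) ^ (1 / 2 : ℂ) = (t : ℂ) := by
    rw [← Complex.ofReal_pow, show (1 / 2 : ℂ) = ((1 / 2 : ℝ) : ℂ) by push_cast; ring,
      ← Complex.ofReal_cpow (by positivity), ← Real.sqrt_eq_rpow, Real.sqrt_sq ht.le]
  have hFG : ∀ x : ℝ, 𝓕 G x = ((t⁻¹ * Real.exp (-(π * x ^ 2 / t ^ 2)) : ℝ) : ℂ) := by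
    intro x
    have h := congrFun (fourier_gaussian_pi hb) x
    rw [hG, h, hcpow, Complex.ofReal_mul, Complex.ofReal_exp, Complex.ofReal_inv, one_div]
    congr 1
    congr 1
    push_cast
    ring
  have hinv : 𝓕⁻ (𝓕 φ) = φ := hφc.fourierInv_fourier_eq hφi hψi
  calc ∫ y : ℝ, (Real.exp (-(π * t ^ 2 * y ^ 2)) : ℂ) * φ y
      = ∫ y : ℝ, G y * 𝓕 (𝓕 φ) (-y) := by
        refine integral_congr_ae (ae_of_all _ fun y => ?_)
        simp only
        rw [hGeq y, ← Real.fourierInv_eq_fourier_neg, hinv]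
    _ = ∫ y : ℝ, G (-y) * 𝓕 (𝓕 φ) y := by
        rw [← integral_neg_eq_self (fun y => G (-y) * 𝓕 (𝓕 φ) y) volume]
        simp only [neg_neg]
    _ = ∫ y : ℝ, G y * 𝓕 (𝓕 φ) y := by
        refine integral_congr_ae (ae_of_all _ fun y => ?_)
        simp only
        rw [hGev]
    _ = ∫ x : ℝ, 𝓕 G x * 𝓕 φ x := (integral_fourier_mul_eq_flip_aux hGi hψi).symm
    _ = ∫ x : ℝ, ((t⁻¹ * Real.exp (-(π * x ^ 2 / t ^ 2)) : ℝ) : ℂ) * 𝓕 φ x := by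
        refine integral_congr_ae (ae_of_all _ fun x => ?_)
        simp only
        rw [hFG x]

/-- If `φ` is continuous and integrable with `𝓕φ` integrable and `φ(0) = 0`, then `∫ 𝓕φ = 0`
(Fourier inversion at the origin). [folklore] -/
private theorem integral_fourier_eq_zero_of_apply_zero {φ : ℝ → ℂ} (hφc : Continuous φ)
    (hφi : Integrable φ) (hψi : Integrable (𝓕 φ)) (h0 : φ 0 = 0) :
    ∫ x : ℝ, 𝓕 φ x = 0 := by
  have h := hφi.fourierInv_fourier_eq hψi (hφc.continuousAt (x := 0))
  rw [h0, Real.fourierInv_eq] at h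
  simpa using h

/-! ### Step D: the substitution `y = t⁻²` -/

/-- `∫₀^∞ (∫ t⁻¹(e^{−πx²/t²} − e^{−π/t²}) ψ(x) dx) dt = ∫₀^∞ (∫ (e^{−πx²y} − e^{−πy})/(2y) ψ(x) dx) dy`
(substitution `y = t⁻²`, `integral_comp_rpow_Ioi`; no integrability needed). [folklore] -/
private theorem integral_Ioi_kernel_subst (ψ : ℝ → ℂ) :
    ∫ t in Ioi (0 : ℝ), ∫ x : ℝ,
        ((t⁻¹ * (Real.exp (-(π * x ^ 2 / t ^ 2)) - Real.exp (-(π / t ^ 2))) : ℝ) : ℂ) * ψ x =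
      ∫ y in Ioi (0 : ℝ), ∫ x : ℝ,
        (((Real.exp (-(π * x ^ 2 * y)) - Real.exp (-(π * y))) / (2 * y) : ℝ) : ℂ) * ψ x := by
  rw [← integral_comp_rpow_Ioi (fun y : ℝ => ∫ x : ℝ,
      (((Real.exp (-(π * x ^ 2 * y)) - Real.exp (-(π * y))) / (2 * y) : ℝ) : ℂ) * ψ x)
    (p := -2) (by norm_num)]
  refine setIntegral_congr_fun measurableSet_Ioi fun t ht => ?_
  have ht0 : (0 : ℝ) < t := ht
  have h2 : t ^ ((-2 : ℝ) - 1) = (t ^ 3)⁻¹ := by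
    rw [show (-2 : ℝ) - 1 = -3 by norm_num, Real.rpow_neg ht0.le,
      show (3 : ℝ) = ((3 : ℕ) : ℝ) by norm_num, Real.rpow_natCast]
  have h3 : t ^ (-2 : ℝ) = (t ^ 2)⁻¹ := by
    rw [Real.rpow_neg ht0.le, show (2 : ℝ) = ((2 : ℕ) : ℝ) by norm_num, Real.rpow_natCast]
  rw [h2, h3, ← integral_smul]
  refine integral_congr_ae (ae_of_all _ fun x => ?_)
  simp only
  rw [Complex.real_smul, ← mul_assoc, ← Complex.ofReal_mul]
  congr 1
  have ht3 : (t ^ 3 : ℝ) ≠ 0 := by positivity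
  have ht2 : (t ^ 2 : ℝ) ≠ 0 := by positivity
  rw [abs_neg, abs_two]
  simp only [div_eq_mul_inv]
  field_simp

/-! ### Step E: Fubini #2 and the Frullani evaluation -/

/-- For `x ≠ 0`: `∫₀^∞ (e^{−π x² y} − e^{−π y})/(2y) dy = −log|x|` (the tree's exponential
Frullani integral `integral_frullani_exp`). [folklore] -/
private theorem integral_Ioi_frullani_gauss {x : ℝ} (hx : x ≠ 0) :
    ∫ y in Ioi (0 : ℝ), (Real.exp (-(π * x ^ 2 * y)) - Real.exp (-(π * y))) / (2 * y) =
      -Real.log x := by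
  have hπ := Real.pi_pos
  have ha : 0 < π * x ^ 2 := by positivity
  have h := Literature.Analysis.SpecialFunctions.integral_frullani_exp ha hπ
  have hfun : (fun y : ℝ => (Real.exp (-(π * x ^ 2 * y)) - Real.exp (-(π * y))) / (2 * y)) =
      fun y => (1 / 2 : ℝ) * ((Real.exp (-(π * x ^ 2 * y)) - Real.exp (-(π * y))) / y) := by
    funext y; ring
  rw [hfun, integral_const_mul, h]
  have hx2 : (x ^ 2 : ℝ) ≠ 0 := pow_ne_zero 2 hx
  have : π / (π * x ^ 2) = (x ^ 2)⁻¹ := by field_simp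
  rw [this, Real.log_inv, Real.log_pow]
  push_cast
  ring

/-- Fubini #2 + Frullani: for `ψ` continuous with `log|x| ψ(x)` absolutely integrable,
`∫₀^∞ (∫ (e^{−πx²y} − e^{−πy})/(2y) ψ(x) dx) dy = −∫ log|x| ψ(x) dx`. [folklore] -/
private theorem integral_Ioi_integral_frullani_mul_eq {ψ : ℝ → ℂ} (hψc : Continuous ψ)
    (hlog : Integrable fun x : ℝ => ‖Real.log x‖ * ‖ψ x‖) :
    ∫ y in Ioi (0 : ℝ), ∫ x : ℝ,
        (((Real.exp (-(π * x ^ 2 * y)) - Real.exp (-(π * y))) / (2 * y) : ℝ) : ℂ) * ψ x =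
      -∫ x : ℝ, (Real.log x : ℂ) * ψ x := by
  set F : ℝ → ℝ → ℂ := fun y x =>
    (((Real.exp (-(π * x ^ 2 * y)) - Real.exp (-(π * y))) / (2 * y) : ℝ) : ℂ) * ψ x with hF
  have hae : ∀ᵐ x : ℝ, x ≠ 0 := by simp [ae_iff]
  -- sign of the kernel
  have hker_nonneg : ∀ x : ℝ, x ^ 2 ≤ 1 → ∀ y : ℝ, 0 < y →
      0 ≤ (Real.exp (-(π * x ^ 2 * y)) - Real.exp (-(π * y))) / (2 * y) := by
    intro x hx y hy
    apply div_nonneg _ (by positivity)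
    rw [sub_nonneg]
    apply Real.exp_le_exp.2
    have := mul_le_mul_of_nonneg_left hx (by positivity : 0 ≤ π * y)
    nlinarith
  have hker_nonpos : ∀ x : ℝ, 1 ≤ x ^ 2 → ∀ y : ℝ, 0 < y →
      (Real.exp (-(π * x ^ 2 * y)) - Real.exp (-(π * y))) / (2 * y) ≤ 0 := by
    intro x hx y hy
    apply div_nonpos_of_nonpos_of_nonneg _ (by positivity)
    rw [sub_nonpos]
    apply Real.exp_le_exp.2
    have := mul_le_mul_of_nonneg_left hx (by positivity : 0 ≤ π * y)
    nlinarith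
  -- the norm integral over `y`
  have hnorm : ∀ x : ℝ, x ≠ 0 → ∫ y in Ioi (0 : ℝ), ‖F y x‖ = ‖Real.log x‖ * ‖ψ x‖ := by
    intro x hx
    have hn : ∀ y, ‖F y x‖ =
        |(Real.exp (-(π * x ^ 2 * y)) - Real.exp (-(π * y))) / (2 * y)| * ‖ψ x‖ := by
      intro y
      rw [hF]
      simp only [norm_mul, Complex.norm_real, Real.norm_eq_abs]
    simp_rw [hn]
    rw [integral_mul_const]
    congr 1
    rcases le_total (x ^ 2) 1 with hx1 | hx1
    · rw [setIntegral_congr_fun measurableSet_Ioi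
          (fun y hy => abs_of_nonneg (hker_nonneg x hx1 y hy)), integral_Ioi_frullani_gauss hx]
      have hxa : |x| ≤ 1 := (sq_le_one_iff_abs_le_one x).1 hx1
      rw [Real.norm_eq_abs, ← Real.log_abs,
        abs_of_nonpos (Real.log_nonpos (abs_nonneg x) hxa)]
    · rw [setIntegral_congr_fun measurableSet_Ioi
          (fun y hy => abs_of_nonpos (hker_nonpos x hx1 y hy)), integral_neg,
        integral_Ioi_frullani_gauss hx, neg_neg]
      have hxa : 1 ≤ |x| := (one_le_sq_iff_one_le_abs x).1 hx1
      rw [Real.norm_eq_abs, ← Real.log_abs, abs_of_nonneg (Real.log_nonneg hxa)]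
  -- integrability on `(0, ∞) × ℝ`
  have hmeasF : Measurable (Function.uncurry F) := by
    have h1 : Measurable fun p : ℝ × ℝ =>
        (Real.exp (-(π * p.2 ^ 2 * p.1)) - Real.exp (-(π * p.1))) / (2 * p.1) := by
      fun_prop
    exact (Complex.measurable_ofReal.comp h1).mul (hψc.measurable.comp measurable_snd)
  have hint : Integrable (Function.uncurry F)
      ((volume.restrict (Ioi (0 : ℝ))).prod (volume : Measure ℝ)) := by
    rw [integrable_prod_iff' hmeasF.aestronglyMeasurable]
    constructor
    · filter_upwards [hae] with x hx
      have hk := Literature.Analysis.SpecialFunctions.integrableOn_frullaniKernel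
        (α := ((π * x ^ 2 : ℝ) : ℂ)) (β := ((π : ℝ) : ℂ))
        (by rw [Complex.ofReal_re]; positivity) (by rw [Complex.ofReal_re]; positivity)
      have heq : (fun y => Function.uncurry F (y, x)) = fun y =>
          Literature.Analysis.SpecialFunctions.frullaniKernel ((π * x ^ 2 : ℝ) : ℂ)
            ((π : ℝ) : ℂ) y / 2 * ψ x := by
        funext y
        simp only [Function.uncurry, hF, Literature.Analysis.SpecialFunctions.frullaniKernel]
        push_cast
        ring
      rw [heq]
      exact (hk.div_const 2).mul_const _
    · refine hlog.congr ?_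
      filter_upwards [hae] with x hx
      exact (hnorm x hx).symm
  -- swap and evaluate
  calc ∫ y in Ioi (0 : ℝ), ∫ x : ℝ, F y x
      = ∫ x : ℝ, ∫ y in Ioi (0 : ℝ), F y x := integral_integral_swap hint
    _ = ∫ x : ℝ, ((-Real.log x : ℝ) : ℂ) * ψ x := by
        apply integral_congr_ae
        filter_upwards [hae] with x hx
        simp only [hF]
        rw [integral_mul_const, integral_complex_ofReal, integral_Ioi_frullani_gauss hx]
    _ = -∫ x : ℝ, (Real.log x : ℂ) * ψ x := by
        rw [← integral_neg]
        refine integral_congr_ae (ae_of_all _ fun x => ?_)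
        simp only
        push_cast
        ring

/-! ### Step F: `𝓕(log|x|) = −1/(2|y|)` away from `0` -/

/-- **The Fourier transform of `log|x|` away from the origin** (weak form): if `φ : ℝ → ℂ` is
continuous and integrable, `𝓕φ` is integrable, `log|x| 𝓕φ(x)` is absolutely integrable, and `φ`
vanishes on `(−δ, δ)`, then `∫ log|x| · 𝓕φ(x) dx = −∫ φ(y)/(2|y|) dy`.  (Equivalently: the
tempered distribution `𝓕(log|x|)` coincides off `0` with `−1/(2|y|)`; by parity the same holds
for `𝓕⁻`.)  This is the printed "`ℓ̂` is the Weil principal value `1/|y|`" for `ℓ = −log(x²)`,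
divided by `−2`; the printed form is `integral_neg_log_sq_mul_fourier_eq` below.
[cite: ConnesMoscovici2022, Lemma 1.4 (i), proof (= arXiv:2112.05500 Lemma 2.4 (i) proof, chunk p0005:L79–L81)] -/
theorem integral_log_mul_fourier_eq {φ : ℝ → ℂ} (hφc : Continuous φ) (hφi : Integrable φ)
    (hψi : Integrable (𝓕 φ)) (hlog : Integrable fun x : ℝ => ‖Real.log x‖ * ‖𝓕 φ x‖)
    {δ : ℝ} (hδ : 0 < δ) (h0 : ∀ y, |y| < δ → φ y = 0) :
    ∫ x : ℝ, (Real.log x : ℂ) * 𝓕 φ x = -∫ y : ℝ, ((1 / (2 * |y|) : ℝ) : ℂ) * φ y := by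
  have hψc : Continuous (𝓕 φ) :=
    VectorFourier.fourierIntegral_continuous Real.continuous_fourierChar
      (by exact continuous_inner) hφi
  have hφ0 : φ 0 = 0 := h0 0 (by simpa using hδ)
  have hzero := integral_fourier_eq_zero_of_apply_zero hφc hφi hψi hφ0
  have h1 : ∀ t : ℝ, 0 < t → ∫ y : ℝ, (Real.exp (-(π * t ^ 2 * y ^ 2)) : ℂ) * φ y =
      ∫ x : ℝ, ((t⁻¹ * (Real.exp (-(π * x ^ 2 / t ^ 2)) - Real.exp (-(π / t ^ 2))) : ℝ) : ℂ) *
        𝓕 φ x := by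
    intro t ht
    rw [integral_gaussian_mul_eq_integral_fourier hφc hφi hψi ht]
    have hA : Integrable fun x : ℝ =>
        ((t⁻¹ * Real.exp (-(π * x ^ 2 / t ^ 2)) : ℝ) : ℂ) * 𝓕 φ x := by
      refine hψi.bdd_mul (c := t⁻¹) ?_ (ae_of_all _ fun x => ?_)
      · exact (Complex.continuous_ofReal.comp (by fun_prop)).aestronglyMeasurable
      · rw [Complex.norm_real, Real.norm_eq_abs, abs_of_nonneg (by positivity)]
        refine mul_le_of_le_one_right (by positivity) (Real.exp_le_one_iff.2 ?_)
        have : 0 ≤ π * x ^ 2 / t ^ 2 := by positivity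
        linarith
    have hB : Integrable fun x : ℝ => ((t⁻¹ * Real.exp (-(π / t ^ 2)) : ℝ) : ℂ) * 𝓕 φ x :=
      hψi.const_mul _
    have hsplit : ∀ x : ℝ,
        ((t⁻¹ * (Real.exp (-(π * x ^ 2 / t ^ 2)) - Real.exp (-(π / t ^ 2))) : ℝ) : ℂ) * 𝓕 φ x =
          ((t⁻¹ * Real.exp (-(π * x ^ 2 / t ^ 2)) : ℝ) : ℂ) * 𝓕 φ x -
            ((t⁻¹ * Real.exp (-(π / t ^ 2)) : ℝ) : ℂ) * 𝓕 φ x := by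
      intro x; push_cast; ring
    simp_rw [hsplit]
    rw [integral_sub hA hB, integral_const_mul, hzero, mul_zero, sub_zero]
  calc ∫ x : ℝ, (Real.log x : ℂ) * 𝓕 φ x
      = -(∫ y in Ioi (0 : ℝ), ∫ x : ℝ,
          (((Real.exp (-(π * x ^ 2 * y)) - Real.exp (-(π * y))) / (2 * y) : ℝ) : ℂ) * 𝓕 φ x) := by
        rw [integral_Ioi_integral_frullani_mul_eq hψc hlog, neg_neg]
    _ = -(∫ t in Ioi (0 : ℝ), ∫ x : ℝ,
          ((t⁻¹ * (Real.exp (-(π * x ^ 2 / t ^ 2)) - Real.exp (-(π / t ^ 2))) : ℝ) : ℂ) *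
            𝓕 φ x) := by
        rw [integral_Ioi_kernel_subst]
    _ = -(∫ t in Ioi (0 : ℝ), ∫ y : ℝ, (Real.exp (-(π * t ^ 2 * y ^ 2)) : ℂ) * φ y) := by
        congr 1
        exact setIntegral_congr_fun measurableSet_Ioi fun t ht => (h1 t ht).symm
    _ = -∫ y : ℝ, ((1 / (2 * |y|) : ℝ) : ℂ) * φ y := by
        rw [integral_inv_two_abs_mul_eq hφc hφi hδ h0]

/-- **`ℓ̂ = 1/|y|` outside `0`, for `ℓ = −log(x²)`** — the statement of the printed proof of
Lemma 1.4 (i) ("One has `x∂ₓℓ = −2`. Thus one gets `∂_y yℓ̂ = 2`. Therefore `yℓ̂` is equal to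
`sign(y)` and `ℓ̂` is the Weil principal value `1/|y|`"), in weak form against every `φ`
(continuous, integrable, `𝓕φ` integrable, `log|x|𝓕φ` absolutely integrable) vanishing near `0`:
`∫ (−log(x²)) 𝓕φ(x) dx = ∫ φ(y)/|y| dy`.
[cite: ConnesMoscovici2022, Lemma 1.4 (i), proof (= arXiv:2112.05500 Lemma 2.4 (i) proof, chunk p0005:L79–L81)] -/
theorem integral_neg_log_sq_mul_fourier_eq {φ : ℝ → ℂ} (hφc : Continuous φ)
    (hφi : Integrable φ) (hψi : Integrable (𝓕 φ))
    (hlog : Integrable fun x : ℝ => ‖Real.log x‖ * ‖𝓕 φ x‖)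
    {δ : ℝ} (hδ : 0 < δ) (h0 : ∀ y, |y| < δ → φ y = 0) :
    ∫ x : ℝ, ((-Real.log (x ^ 2) : ℝ) : ℂ) * 𝓕 φ x = ∫ y : ℝ, ((1 / |y| : ℝ) : ℂ) * φ y := by
  have h := integral_log_mul_fourier_eq hφc hφi hψi hlog hδ h0
  have hl : ∀ x : ℝ, ((-Real.log (x ^ 2) : ℝ) : ℂ) * 𝓕 φ x =
      (-2 : ℂ) * ((Real.log x : ℂ) * 𝓕 φ x) := by
    intro x; rw [Real.log_pow]; push_cast; ring
  have hr : ∀ y : ℝ, ((1 / |y| : ℝ) : ℂ) * φ y =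
      (2 : ℂ) * (((1 / (2 * |y|) : ℝ) : ℂ) * φ y) := by
    intro y
    by_cases hy : y = 0
    · subst hy; simp
    · have hy' : ((|y| : ℝ) : ℂ) ≠ 0 := by exact_mod_cast abs_ne_zero.2 hy
      push_cast
      field_simp
  simp_rw [hl, hr, integral_const_mul, h]
  ring

/-! ### Step G: Schwartz bookkeeping and translation -/

/-- For a Schwartz function `ψ` and `a ∈ ℝ`, `u ↦ log|u − a| · ψ(u)` is absolutely integrable
(`log` is integrable near `a`, and `≤ |u − a|` far from it) — i.e. `log|x ∓ λ|`, hence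
`f = ½ log((λ² − x²)⁻²)`, "viewed as a tempered distribution" pairs absolutely with Schwartz
functions. [cite: ConnesMoscovici2022, Lemma 1.4 (i) (= arXiv:2112.05500 Lemma 2.4 (i), chunk p0005:L72)] -/
theorem integrable_norm_log_sub_mul (ψ : 𝓢(ℝ, ℂ)) (a : ℝ) :
    Integrable fun u : ℝ => ‖Real.log (u - a)‖ * ‖ψ u‖ := by
  set C : ℝ := SchwartzMap.seminorm ℂ 0 0 ψ with hC_def
  have hC : ∀ u, ‖ψ u‖ ≤ C := fun u => SchwartzMap.norm_le_seminorm ℂ ψ u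
  have h1 : Integrable fun u : ℝ => ‖u‖ ^ 1 * ‖ψ u‖ := ψ.integrable_pow_mul volume 1
  have h0 : Integrable fun u : ℝ => ‖ψ u‖ := (ψ.integrable (μ := volume)).norm
  have hloc : IntegrableOn (fun u => ‖Real.log (u - a)‖) (Icc (a - 1) (a + 1)) := by
    have h := ((intervalIntegral.intervalIntegrable_log' (a := -1) (b := 1)).comp_sub_right a).norm
    rw [intervalIntegrable_iff_integrableOn_Icc_of_le (by linarith)] at h
    have hI : Icc (a - 1) (a + 1) = Icc (-1 + a) (1 + a) := by
      congr 1 <;> ring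
    rw [hI]
    exact h
  set B : ℝ → ℝ := fun u =>
    (Icc (a - 1) (a + 1)).indicator (fun u => ‖Real.log (u - a)‖) u * C +
      (‖u‖ ^ 1 * ‖ψ u‖ + |a| * ‖ψ u‖) with hB_def
  have hB : Integrable B :=
    ((hloc.integrable_indicator measurableSet_Icc).mul_const C).add (h1.add (h0.const_mul _))
  refine hB.mono' ?_ (ae_of_all _ fun u => ?_)
  · exact ((Real.measurable_log.comp (measurable_id.sub_const a)).norm.mul
      ψ.continuous.measurable.norm).aestronglyMeasurable
  · rw [Real.norm_eq_abs, abs_of_nonneg (by positivity)]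
    by_cases hu : u ∈ Icc (a - 1) (a + 1)
    · simp only [hB_def, indicator_of_mem hu]
      have h' : ‖Real.log (u - a)‖ * ‖ψ u‖ ≤ ‖Real.log (u - a)‖ * C :=
        mul_le_mul_of_nonneg_left (hC u) (norm_nonneg _)
      have h'' : 0 ≤ ‖u‖ ^ 1 * ‖ψ u‖ + |a| * ‖ψ u‖ := by positivity
      linarith
    · simp only [hB_def, indicator_of_notMem hu, zero_mul, zero_add]
      have hua : 1 < |u - a| := by
        simp only [mem_Icc, not_and_or, not_le] at hu
        rcases hu with h | h
        · rw [abs_of_neg (by linarith)]; linarith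
        · rw [abs_of_pos (by linarith)]; linarith
      have hlogpos : 0 ≤ Real.log (u - a) := by
        rw [← Real.log_abs]; exact Real.log_nonneg hua.le
      have hle : Real.log (u - a) ≤ |u - a| := by
        rw [← Real.log_abs]
        exact (Real.log_le_sub_one_of_pos (by linarith)).trans (by linarith)
      rw [Real.norm_eq_abs, abs_of_nonneg hlogpos, pow_one, Real.norm_eq_abs]
      calc Real.log (u - a) * ‖ψ u‖ ≤ |u - a| * ‖ψ u‖ := by gcongr
        _ ≤ (|u| + |a|) * ‖ψ u‖ := by gcongr; exact abs_sub u a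
        _ = |u| * ‖ψ u‖ + |a| * ‖ψ u‖ := by ring

/-- A Schwartz function with `0 ∉ tsupport φ` vanishes on some `(−δ, δ)`. [folklore] -/
private theorem exists_forall_abs_lt_eq_zero (φ : 𝓢(ℝ, ℂ)) (hφ0 : (0 : ℝ) ∉ tsupport (φ : ℝ → ℂ)) :
    ∃ δ > 0, ∀ y : ℝ, |y| < δ → φ y = 0 := by
  have h := notMem_tsupport_iff_eventuallyEq.1 hφ0
  obtain ⟨δ, hδ, h⟩ := Metric.eventually_nhds_iff.1 h
  exact ⟨δ, hδ, fun y hy => h (by simpa [Real.dist_eq] using hy)⟩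

/-- **Translated form** (Schwartz `φ`, `0 ∉ tsupport φ`):
`∫ log|x − a| · 𝓕φ(x) dx = −∫ e^{−2πiay} φ(y)/(2|y|) dy` ("translation of the variable means
multiplication by an imaginary exponential in Fourier").
[cite: ConnesMoscovici2022, Lemma 1.4 (i) proof (= arXiv:2112.05500 Lemma 2.4, chunk p0005:L81)] -/
theorem integral_log_sub_mul_fourier_schwartz (φ : 𝓢(ℝ, ℂ))
    (hφ0 : (0 : ℝ) ∉ tsupport (φ : ℝ → ℂ)) (a : ℝ) :
    ∫ x : ℝ, (Real.log (x - a) : ℂ) * 𝓕 (φ : ℝ → ℂ) x =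
      -∫ y : ℝ, ((1 / (2 * |y|) : ℝ) : ℂ) *
        (Complex.exp (((-2 * π * y * a : ℝ) : ℂ) * Complex.I) * φ y) := by
  obtain ⟨δ, hδ, hδ0⟩ := exists_forall_abs_lt_eq_zero φ hφ0
  set φa : ℝ → ℂ := fun y => Complex.exp (((-2 * π * y * a : ℝ) : ℂ) * Complex.I) * φ y
    with hφa
  have hφac : Continuous φa := by
    rw [hφa]
    exact (Complex.continuous_exp.comp (by fun_prop)).mul φ.continuous
  have hφai : Integrable φa := by
    refine (φ.integrable (μ := volume)).bdd_mul (c := 1) ?_ (ae_of_all _ fun y => ?_)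
    · exact (Complex.continuous_exp.comp (by fun_prop)).aestronglyMeasurable
    · rw [Complex.norm_exp_ofReal_mul_I]
  have hFa : 𝓕 φa = fun x => 𝓕 (φ : ℝ → ℂ) (x + a) := by
    funext x
    rw [Real.fourier_real_eq_integral_exp_smul, Real.fourier_real_eq_integral_exp_smul]
    refine integral_congr_ae (ae_of_all _ fun v => ?_)
    simp only [hφa, smul_eq_mul]
    rw [← mul_assoc, ← Complex.exp_add]
    congr 2
    push_cast
    ring
  set ψ : 𝓢(ℝ, ℂ) := 𝓕 φ with hψ
  have hψfun : 𝓕 (φ : ℝ → ℂ) = (ψ : ℝ → ℂ) := by rw [hψ, SchwartzMap.fourier_coe]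
  have hψai : Integrable (𝓕 φa) := by
    rw [hFa, hψfun]
    exact (ψ.integrable (μ := volume)).comp_add_right a
  have hlog : Integrable fun x : ℝ => ‖Real.log x‖ * ‖𝓕 φa x‖ := by
    rw [hFa, hψfun]
    have h := (integrable_norm_log_sub_mul ψ a).comp_add_right a
    refine h.congr (ae_of_all _ fun x => ?_)
    simp
  have hvan : ∀ y, |y| < δ → φa y = 0 := fun y hy => by simp [hφa, hδ0 y hy]
  have hmain := integral_log_mul_fourier_eq hφac hφai hψai hlog hδ hvan
  rw [hFa] at hmain
  have hshift : ∫ x : ℝ, (Real.log x : ℂ) * 𝓕 (φ : ℝ → ℂ) (x + a) =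
      ∫ u : ℝ, (Real.log (u - a) : ℂ) * 𝓕 (φ : ℝ → ℂ) u := by
    have := integral_add_right_eq_self (μ := (volume : Measure ℝ))
      (fun u : ℝ => (Real.log (u - a) : ℂ) * 𝓕 (φ : ℝ → ℂ) u) a
    simpa using this
  rw [← hshift]
  exact hmain

/-! ### The discharge -/

/-- RH-FREE, PROVED: discharge of the named fact `CM22_lemma_1_4_i` (**Lemma 1.4 (i)** of
Connes–Moscovici 2022 = arXiv Lemma 2.4 (i)): for `λ > 0` and Schwartz `φ` with `0 ∉ tsupport φ`,
`∫ ½ log((λ² − x²)⁻²) 𝓕φ(x) dx = ∫ cos(2πλy)/|y| φ(y) dy`.  Proof: `½ log((λ² − x²)⁻²) =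
−log|x − λ| − log|x + λ|` a.e., the translated Fourier transform of `log|x|`
(`integral_log_sub_mul_fourier_schwartz`, `a = ±λ`), and `e^{−iθ} + e^{iθ} = 2 cos θ`.
[cite: ConnesMoscovici2022, Lemma 1.4 (i) (= arXiv:2112.05500 Lemma 2.4 (i), chunk p0005:L71–L81)] -/
theorem CM22_lemma_1_4_i_holds : CM22_lemma_1_4_i := by
  intro lam hlam φ hφ0
  set ψ : 𝓢(ℝ, ℂ) := 𝓕 φ with hψ
  have hψfun : 𝓕 (φ : ℝ → ℂ) = (ψ : ℝ → ℂ) := by rw [hψ, SchwartzMap.fourier_coe]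
  -- integrability of `log|x − a| · 𝓕φ`
  have hint : ∀ a : ℝ, Integrable fun x : ℝ => (Real.log (x - a) : ℂ) * 𝓕 (φ : ℝ → ℂ) x := by
    intro a
    rw [hψfun]
    refine (integrable_norm_log_sub_mul ψ a).mono' ?_ (ae_of_all _ fun x => ?_)
    · exact ((Complex.measurable_ofReal.comp
        (Real.measurable_log.comp (measurable_id.sub_const a))).mul
          ψ.continuous.measurable).aestronglyMeasurable
    · rw [norm_mul, Complex.norm_real]
  -- the integrand a.e.
  have hae : ∀ᵐ x : ℝ, x ≠ lam ∧ x ≠ -lam := by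
    have h1 : ∀ᵐ x : ℝ, x ≠ lam := by simp [ae_iff]
    have h2 : ∀ᵐ x : ℝ, x ≠ -lam := by simp [ae_iff]
    filter_upwards [h1, h2] with x h1 h2 using ⟨h1, h2⟩
  have hlhs : ∫ x : ℝ, (((1 / 2 : ℝ) * Real.log ((lam ^ 2 - x ^ 2) ^ 2)⁻¹ : ℝ) : ℂ) *
        𝓕 (φ : ℝ → ℂ) x =
      (-∫ x : ℝ, (Real.log (x - lam) : ℂ) * 𝓕 (φ : ℝ → ℂ) x) -
        ∫ x : ℝ, (Real.log (x - -lam) : ℂ) * 𝓕 (φ : ℝ → ℂ) x := by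
    have hneg : Integrable fun x : ℝ => -((Real.log (x - lam) : ℂ) * 𝓕 (φ : ℝ → ℂ) x) :=
      (hint lam).neg
    rw [← integral_neg, ← integral_sub hneg (hint (-lam))]
    apply integral_congr_ae
    filter_upwards [hae] with x hx
    obtain ⟨hx1, hx2⟩ := hx
    have hl : (1 / 2 : ℝ) * Real.log ((lam ^ 2 - x ^ 2) ^ 2)⁻¹ =
        -(Real.log (x - lam) + Real.log (x - -lam)) := by
      rw [Real.log_inv, Real.log_pow, show lam ^ 2 - x ^ 2 = (-(x - lam)) * (x - -lam) by ring,
        Real.log_mul (neg_ne_zero.2 (sub_ne_zero.2 hx1)) (sub_ne_zero.2 hx2),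
        Real.log_neg_eq_log]
      push_cast
      ring
    rw [hl]
    push_cast
    ring
  rw [hlhs, integral_log_sub_mul_fourier_schwartz φ hφ0 lam,
    integral_log_sub_mul_fourier_schwartz φ hφ0 (-lam), neg_neg, sub_neg_eq_add]
  -- combine the two exponentials into a cosine
  obtain ⟨δ, hδ, hδ0⟩ := exists_forall_abs_lt_eq_zero φ hφ0
  have hm : Measurable fun y : ℝ => 1 / (2 * |y|) :=
    (measurable_const.mul continuous_abs.measurable).const_div 1
  have hI : ∀ a : ℝ, Integrable fun y : ℝ => ((1 / (2 * |y|) : ℝ) : ℂ) *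
      (Complex.exp (((-2 * π * y * a : ℝ) : ℂ) * Complex.I) * φ y) := by
    intro a
    refine Integrable.mono' ((φ.integrable (μ := volume)).norm.const_mul (1 / (2 * δ))) ?_
      (ae_of_all _ fun y => ?_)
    · exact (Complex.measurable_ofReal.comp hm).aestronglyMeasurable.mul
        ((Complex.continuous_exp.comp (by fun_prop)).mul φ.continuous).aestronglyMeasurable
    · rw [norm_mul, norm_mul, Complex.norm_exp_ofReal_mul_I, one_mul, Complex.norm_real,
        Real.norm_eq_abs, abs_of_nonneg (by positivity)]
      by_cases hy : φ y = 0
      · simp [hy]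
      · have hyδ : δ ≤ |y| := not_lt.1 fun h => hy (hδ0 y h)
        gcongr
  rw [← integral_add (hI lam) (hI (-lam))]
  refine integral_congr_ae (ae_of_all _ fun y => ?_)
  simp only
  have e1 : Complex.exp (((-2 * π * y * lam : ℝ) : ℂ) * Complex.I) =
      Complex.exp (-((2 * π * lam * y : ℝ) : ℂ) * Complex.I) := by
    congr 1; push_cast; ring
  have e2 : Complex.exp (((-2 * π * y * -lam : ℝ) : ℂ) * Complex.I) =
      Complex.exp (((2 * π * lam * y : ℝ) : ℂ) * Complex.I) := by
    congr 1; push_cast; ring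
  have hcos : ((Real.cos (2 * π * lam * y) / |y| : ℝ) : ℂ) =
      ((1 / (2 * |y|) : ℝ) : ℂ) * (Complex.exp (((2 * π * lam * y : ℝ) : ℂ) * Complex.I) +
        Complex.exp (-((2 * π * lam * y : ℝ) : ℂ) * Complex.I)) := by
    rw [← Complex.two_cos, ← Complex.ofReal_cos, Complex.ofReal_div, Complex.ofReal_div,
      Complex.ofReal_mul, Complex.ofReal_one]
    push_cast
    ring
  rw [e1, e2, hcos]
  ring

end Literature.NumberTheory.ConnesMoscovici2022

end
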